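import Literature.AlgebraicGeometry.Kloosterman2025.ArtinianGorensteinOfFunctional
import Mathlib.LinearAlgebra.Matrix.Rank
import HarnessLib

/-!
# Movasati's period matrix `[p_{i+j}]`: its rank is the Hilbert function of the Voisin–Otwinowska ideal

H. Movasati, *Why should one compute periods of algebraic cycles?*, arXiv:1602.06607 (= Ch. 18 of *A Course
in Hodge Theory*, Int. Press 2021) [Movasati2016Periods], §4:

* **Definition 1** (p. 8): "For natural numbers `N`, `n` and `d` let us define
  `I_N := {(i_0, i_1, …, i_{n+1}) ∈ ℤ^{n+2} | 0 ≤ i_e ≤ d − 2, i_0 + i_1 + ⋯ + i_{n+1} = N}`. Assume that `n` is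
  even and `d ≥ 2 + 4/n`. Consider complex numbers `p_i` indexed by `i ∈ I_{(n/2+1)d−n−2}`. For any other `i`
  which is not in the set `I_{(n/2+1)d−n−2}`, we define `p_i` to be zero. Let `[p_{i+j}]` be a matrix whose rows
  and columns are indexed by `i ∈ I_{(n/2)d−n−2}` and `j ∈ I_d`, respectively, and in its `(i,j)` entry we have
  `p_{i+j}`." (The same matrix, with indeterminate entries `x_{i+j}`, is the matrix `M` "obtained by IVHS for the
  Fermat point" of [Movasati2017GMCD] §1 and §3.4, and the matrix `[ρ_{i+j}]` of [MovasatiVillaflor2018] §5.)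
* **Theorem 6** (p. 8): for a Hodge cycle `δ₀` of the Fermat variety `X^d_n` with periods
  `p_i = ∫_{δ₀} ω_i`, "The kernel of the matrix `[p_{i+j}]` is canonically identified with the Zariski tangent
  space of the Hodge locus `V_{δ₀}` passing through `0 ∈ T`" — so that `codim T_0 V_{δ₀} = rank [p_{i+j}]`.

R. Villaflor Loyola, *Small codimension components of the Hodge locus containing the Fermat variety*,
Commun. Contemp. Math. 24 (2022) [Villaflorloyola2021], §2:

* **Definition 2.1** (Voisin–Otwinowska): `J^{F,λ}_i := {P ∈ ℂ[x]_i : ∫_X res(PQ Ω/F^{n/2+1}) ∧ λ = 0 ∀ Q ∈ ℂ[x]_{σ−i}}`,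
  `σ = (d−2)(n/2+1)` — i.e. `J^{F,λ}` is the (graded) ANNIHILATOR IDEAL of the period functional
  `ℓ_λ : R ↦ ∫_X res(R Ω/F^{n/2+1}) ∧ λ` on `ℂ[x]_σ` (the tree's `Kloosterman2025.annIdeal ℓ_λ`,
  [Kloosterman2025] Lemma 2.1), whose values on the monomials `x^i`, `i ∈ I_σ`, are Movasati's periods `p_i`;
* **Proposition 2.1**: `T_t V_λ = J^{F,λ}_d`; **Proposition 2.2**: `R^{F,λ} = ℂ[x]/J^{F,λ}` is Artinian Gorenstein
  of socle `σ` and `J^{F,λ} = (J^F : P_λ)` ([DuqueFrancoVillaflor2025Join] Def. 2.2 and eq. (2.3)).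

## What this file PROVES (0 facts, 0 sorry) — the algebra common to Theorem 6 and Proposition 2.1

For ANY field `K`, any number `m` of variables (`m = n + 2`), any `d`, and any linear functional
`ℓ : K[x_0,…,x_{m−1}] → K` which kills every monomial having an exponent `≥ d − 1` (as every period functional
of the Fermat variety does: such monomials lie in the Jacobian ideal `J^F = (x_e^{d−1})`), with period vector
`p_i := ℓ(x^i)` (`periodVector ℓ`):

* `indexSet m d N` — Definition 1's `I_N` (exponent vectors `i : Fin m → ℕ` with `i_e ≤ d − 2`, `|i| = N`), in the
  SAME shape as the census schema `Summits/HodgeConjecture/HodgeConjecture/Theorems/HodgeLocusCensusSchema.lean`;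
* `periodMatrix m d N M p` — the matrix `[p_{i+j}]`, rows `i ∈ I_N`, columns `j ∈ I_M` (Movasati: `N = (n/2)d−n−2`,
  `M = d`);
* **`rank_periodMatrix_periodVector`**: `rank [p_{i+j}] = rank` of the graded multiplication pairing
  `S_M × S_N → K`, `(g,h) ↦ ℓ(gh)` (tree `Kloosterman2025.gradedMulForm ℓ M N`) — the rows/columns that Definition 1
  omits (monomials of `J^F`) are identically zero;
* **`rank_periodMatrix_eq_hilbert`**: if moreover `ℓ` is concentrated in degree `t = M + N` (a period functional:
  `t = σ`), then **`rank [p_{i+j}] = dim_K S_M − dim_K (Ann ℓ)_M = HF_{Ann ℓ}(M)`** — with Definition 2.1's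
  `J^{F,λ} = Ann(ℓ_λ)` this is "`codim ker [p_{i+j}] = codim_{S_d} J^{F,λ}_d`", the common algebraic content of
  Theorem 6 and Proposition 2.1 (both of which are transcendental statements about `T_tV_λ` and are NOT formalised);
  row form `rank_periodMatrix_eq_hilbert_rows` (`= HF_{Ann ℓ}(N)`, Gorenstein symmetry);
* `rank_periodMatrix_smul`: the rank is unchanged by a non-zero scalar (the printed normalisation
  `(−1)^{n/2}/(d^{n/2+1}(n/2)!)` of [MovasatiVillaflor2018] Thm. 1, or a coefficient `c ∈ ℚ^×`).

The companion file `MovasatiVillaflor2018/LinearCyclePeriods.lean` feeds the explicit periods of linear cycles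
(MV18 Thm. 1) into these theorems and obtains `rank [p_{i+j}([ℙ^{n/2}])] = binom(n/2+d, d) − (n/2+1)²`
([Movasati2017GMCD] Thm. 2, §3.5).

## References
* H. Movasati, arXiv:1602.06607v4, Def. 1, Thm. 6. [Movasati2016Periods]
* H. Movasati, Asian J. Math. 21 (2017) 463–482, §1, §3.4. [Movasati2017GMCD]
* H. Movasati, R. Villaflor Loyola, Pure Appl. Math. Q. 14 (2018), §5–6. [MovasatiVillaflor2018]
* R. Villaflor Loyola, Commun. Contemp. Math. 24 (2022) 2150053, Def. 2.1, Prop. 2.1, Prop. 2.2. [Villaflorloyola2021]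
* R. Kloosterman, Rend. Circ. Mat. Palermo 74 (2025), Lemma 2.1, Notation 2.4. [Kloosterman2025]
-/

noncomputable section

open MvPolynomial Module Literature.RingTheory.MvPolynomial Literature.AlgebraicGeometry.Kloosterman2025

attribute [local instance] MvPolynomial.gradedAlgebra

namespace Literature.AlgebraicGeometry.Movasati2016

variable {K : Type*}

/-! ## Definition 1: the index sets `I_N`, the period vector and the matrix `[p_{i+j}]` -/

/-- Movasati's index set `I_N = {i ∈ ℤ^{m} : 0 ≤ i_e ≤ d − 2, i_0 + ⋯ + i_{m−1} = N}` (`m = n + 2` variables),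
as a `Finset` of exponent vectors `Fin m → ℕ` — the monomials `x^i`, `i ∈ I_N`, are a basis of the degree-`N`
piece of the Jacobian ring of the Fermat variety of degree `d`. Same shape as the census schema's `indexSet`.
[cite: Movasati2016Periods, Definition 1] [cite: Movasati2017GMCD, §1] -/
def indexSet (m d N : ℕ) : Finset (Fin m → ℕ) :=
  (Fintype.piFinset fun _ : Fin m => Finset.range (d - 1)).filter fun i => ∑ e, i e = N

/-- Membership in `I_N`: all exponents `< d − 1` and total degree `N`. [cite: Movasati2016Periods, Definition 1] -/
theorem mem_indexSet {m d N : ℕ} {i : Fin m → ℕ} :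
    i ∈ indexSet m d N ↔ (∀ e, i e < d - 1) ∧ ∑ e, i e = N := by
  rw [indexSet, Finset.mem_filter, Fintype.mem_piFinset]
  simp only [Finset.mem_range]

/-- **Movasati's matrix `[p_{i+j}]`**: rows `i ∈ I_N`, columns `j ∈ I_M`, entry `p_{i+j}` (for the Fermat `n`-fold of
degree `d`: `m = n + 2`, `N = (n/2)d − n − 2`, `M = d`; the matrix `M = [x_{i+j}]` "obtained by IVHS for the Fermat
point"). [cite: Movasati2016Periods, Definition 1] [cite: Movasati2017GMCD, §3.4] [cite: MovasatiVillaflor2018, §5] -/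
def periodMatrix (m d N M : ℕ) (p : (Fin m → ℕ) → K) : Matrix (indexSet m d N) (indexSet m d M) K :=
  fun i j => p (fun e => i.1 e + j.1 e)

/-- Entries of `[p_{i+j}]`. [cite: Movasati2016Periods, Definition 1] -/
@[simp] theorem periodMatrix_apply {m d N M : ℕ} (p : (Fin m → ℕ) → K) (i : indexSet m d N) (j : indexSet m d M) :
    periodMatrix m d N M p i j = p (fun e => i.1 e + j.1 e) := rfl

variable [Field K]

/-- The **period vector** `i ↦ p_i := ℓ(x^i)` of a linear functional `ℓ` on `K[x_σ]` (Movasati's periods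
`p_i = ∫_{δ} ω_i` of the monomial forms `ω_i`, read through the period functional of `δ`).
[cite: Movasati2016Periods, Definition 1] [cite: Villaflorloyola2021, Definition 2.1] -/
def periodVector {σ : Type*} [Finite σ] (ℓ : MvPolynomial σ K →ₗ[K] K) (i : σ → ℕ) : K :=
  ℓ (monomial (Finsupp.equivFunOnFinite.symm i) 1)

/-- A common scalar factor of the periods rescales the matrix. [cite: MovasatiVillaflor2018, Theorem 1] -/
theorem periodMatrix_mul {m d N M : ℕ} (c : K) (p : (Fin m → ℕ) → K) :
    periodMatrix m d N M (fun i => c * p i) = c • periodMatrix m d N M p := rfl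

/-- **The rank of `[p_{i+j}]` does not see a non-zero common factor of the periods** (the printed constant
`sign(b)(−1)^{n/2}/(d^{n/2+1}(n/2)!)` of the periods of a linear cycle, or a coefficient `c ∈ ℚ^×` of the cycle).
[cite: MovasatiVillaflor2018, Theorem 1] [cite: Movasati2016Periods, Theorem 6] -/
theorem rank_periodMatrix_mul {m d N M : ℕ} {c : K} (hc : c ≠ 0) (p : (Fin m → ℕ) → K) :
    (periodMatrix m d N M (fun i => c * p i)).rank = (periodMatrix m d N M p).rank := by
  classical
  rw [periodMatrix_mul]
  have h1 : c • periodMatrix m d N M p = (c • (1 : Matrix (indexSet m d N) (indexSet m d N) K)) *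
      periodMatrix m d N M p := by
    rw [Matrix.smul_mul, Matrix.one_mul]
  rw [h1]
  refine Matrix.rank_mul_eq_right_of_isUnit_det _ _ ?_
  rw [Matrix.det_smul, Matrix.det_one, mul_one]
  exact (pow_ne_zero _ hc).isUnit

/-! ## The rank of `[p_{i+j}]` is the rank of the graded pairing of `ℓ` -/

section Rank

variable {m d : ℕ} (ℓ : MvPolynomial (Fin m) K →ₗ[K] K)

/-- `x^i · x^j = x^{i+j}` for exponent vectors read as finitely supported functions. [folklore] -/
private theorem monomial_symm_mul_monomial_symm (i j : Fin m → ℕ) :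
    (monomial (Finsupp.equivFunOnFinite.symm i) (1 : K)) * monomial (Finsupp.equivFunOnFinite.symm j) 1 =
      monomial (Finsupp.equivFunOnFinite.symm fun e => i e + j e) 1 := by
  rw [monomial_mul, one_mul, show Finsupp.equivFunOnFinite.symm i + Finsupp.equivFunOnFinite.symm j =
    Finsupp.equivFunOnFinite.symm (fun e => i e + j e) from Finsupp.ext fun _ => rfl]

/-- The degree of `x^i` is `|i|`. [folklore] -/
private theorem degree_equivFunOnFinite_symm (i : Fin m → ℕ) :
    (Finsupp.equivFunOnFinite.symm i).degree = ∑ e, i e := by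
  rw [Finsupp.degree_eq_sum]
  rfl

/-- `monomial s c = c • x^s`. [folklore] -/
private theorem monomial_eq_smul_monomial_one {σ : Type*} (s : σ →₀ ℕ) (c : K) :
    monomial s c = c • monomial s (1 : K) := by
  rw [smul_monomial, smul_eq_mul, mul_one]

/-- `x^i ∈ S_N` for `i ∈ I_N`. [cite: Movasati2016Periods, Definition 1] -/
theorem monomial_mem_homogeneousSubmodule_of_mem_indexSet {N : ℕ} {i : Fin m → ℕ} (hi : i ∈ indexSet m d N) :
    monomial (Finsupp.equivFunOnFinite.symm i) (1 : K) ∈ homogeneousSubmodule (Fin m) K N :=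
  (mem_homogeneousSubmodule _ _).mpr
    (isHomogeneous_monomial _ (by rw [degree_equivFunOnFinite_symm]; exact (mem_indexSet.mp hi).2))

/-- A functional killing the monomials of `J^F = (x_e^{d−1})` kills `v · x^s` for every `x^s ∈ J^F`
("For any other `i` which is not in the set `I`, we define `p_i` to be zero" is automatic for periods).
[cite: Movasati2016Periods, Definition 1] -/
theorem apply_mul_monomial_eq_zero_of_le
    (hbox : ∀ s : Fin m →₀ ℕ, (∃ e, d - 1 ≤ s e) → ℓ (monomial s 1) = 0)
    (v : MvPolynomial (Fin m) K) {s : Fin m →₀ ℕ} (hs : ∃ e, d - 1 ≤ s e) :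
    ℓ (v * monomial s 1) = 0 := by
  obtain ⟨e, he⟩ := hs
  rw [v.as_sum, Finset.sum_mul, map_sum]
  refine Finset.sum_eq_zero fun u _ => ?_
  rw [monomial_mul, mul_one, monomial_eq_smul_monomial_one, map_smul, hbox (u + s) ⟨e, ?_⟩, smul_zero]
  simp only [Finsupp.coe_add, Pi.add_apply]
  omega

/-- **`rank [p_{i+j}] =` rank of the graded pairing `S_M × S_N → K`, `(g, h) ↦ ℓ(gh)`** (`p = periodVector ℓ`,
rows `I_N`, columns `I_M`), for every functional `ℓ` killing the monomials with an exponent `≥ d − 1`: the matrix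
of Definition 1 is the Gram matrix of the pairing in the monomial bases with the (identically zero) rows and columns
of the monomials of `J^F` deleted. [cite: Movasati2016Periods, Definition 1, Theorem 6]
[cite: Kloosterman2025, Lemma 2.1, Notation 2.4] -/
theorem rank_periodMatrix_periodVector
    (hbox : ∀ s : Fin m →₀ ℕ, (∃ e, d - 1 ≤ s e) → ℓ (monomial s 1) = 0) (N M : ℕ) :
    (periodMatrix m d N M (periodVector ℓ)).rank =
      finrank K (LinearMap.range (gradedMulForm ℓ M N)) := by
  classical
  -- the monomial `x^i` of an exponent vector
  let x : (Fin m → ℕ) → MvPolynomial (Fin m) K := fun i => monomial (Finsupp.equivFunOnFinite.symm i) 1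
  have hx : ∀ i, x i = monomial (Finsupp.equivFunOnFinite.symm i) 1 := fun i => rfl
  have hxmem : ∀ {k : ℕ} (i : indexSet m d k), x i.1 ∈ homogeneousSubmodule (Fin m) K k := fun i =>
    monomial_mem_homogeneousSubmodule_of_mem_indexSet i.2
  -- `Φ : S → K^{I_N}`, `v ↦ (ℓ(x^i v))_{i ∈ I_N}`
  let Φ : MvPolynomial (Fin m) K →ₗ[K] (indexSet m d N → K) :=
    LinearMap.pi fun i => ℓ ∘ₗ LinearMap.mulLeft K (x i.1)
  have hΦ : ∀ v i, Φ v i = ℓ (x i.1 * v) := fun v i => rfl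
  set A := periodMatrix m d N M (periodVector ℓ) with hA
  have hAij : ∀ (i : indexSet m d N) (j : indexSet m d M), A i j = ℓ (x i.1 * x j.1) := by
    intro i j
    rw [hA, periodMatrix_apply, periodVector, hx, hx, monomial_symm_mul_monomial_symm]
  -- Step 1: the column space of `A` is `Φ(S_M)` (only the box monomials of `S_M` matter).
  have h1 : LinearMap.range A.mulVecLin = (homogeneousSubmodule (Fin m) K M).map Φ := by
    apply le_antisymm
    · rintro _ ⟨c, rfl⟩
      refine ⟨∑ j : indexSet m d M, c j • x j.1,
        Submodule.sum_mem _ fun j _ => Submodule.smul_mem _ _ (hxmem j), ?_⟩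
      ext i
      rw [hΦ, Matrix.mulVecLin_apply, Finset.mul_sum, map_sum]
      change ∑ j, ℓ (x i.1 * c j • x j.1) = ∑ j, A i j * c j
      refine Finset.sum_congr rfl fun j _ => ?_
      rw [mul_smul_comm, map_smul, smul_eq_mul, hAij, mul_comm]
    · rintro _ ⟨w, hw, rfl⟩
      refine ⟨fun j => coeff (Finsupp.equivFunOnFinite.symm j.1) w, ?_⟩
      ext i
      rw [Matrix.mulVecLin_apply, hΦ]
      change ∑ j : indexSet m d M, A i j * coeff (Finsupp.equivFunOnFinite.symm j.1) w = ℓ (x i.1 * w)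
      have hwN : w.IsHomogeneous M := (mem_homogeneousSubmodule _ _).mp hw
      -- both sides are the sum of `coeff_s(w) ℓ(x^i x^s)` over the box monomials `x^s` of `w`
      let f : (Fin m →₀ ℕ) → K := fun s => coeff s w * ℓ (x i.1 * monomial s 1)
      let T : Finset (Fin m →₀ ℕ) := (indexSet m d M).map (Finsupp.equivFunOnFinite.symm.toEmbedding)
      have hT : ∀ s : Fin m →₀ ℕ, s ∈ T ↔ (⇑s : Fin m → ℕ) ∈ indexSet m d M := by
        intro s
        constructor
        · rintro hs
          obtain ⟨j, hj, rfl⟩ := Finset.mem_map.mp hs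
          exact hj
        · intro hs
          exact Finset.mem_map.mpr ⟨⇑s, hs, Finsupp.equivFunOnFinite_symm_coe s⟩
      have hR : ∑ j : indexSet m d M, A i j * coeff (Finsupp.equivFunOnFinite.symm j.1) w = ∑ s ∈ T, f s := by
        rw [Finset.sum_map, ← Finset.sum_coe_sort (indexSet m d M)]
        refine Finset.sum_congr rfl fun j _ => ?_
        change A i j * _ = coeff _ w * ℓ (x i.1 * x j.1)
        rw [hAij, mul_comm]
        rfl
      have hL : ℓ (x i.1 * w) = ∑ s ∈ w.support, f s := by
        conv_lhs => rw [w.as_sum, Finset.mul_sum, map_sum]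
        refine Finset.sum_congr rfl fun s _ => ?_
        change ℓ (x i.1 * monomial s (coeff s w)) = coeff s w * ℓ (x i.1 * monomial s 1)
        rw [monomial_eq_smul_monomial_one s (coeff s w), mul_smul_comm, map_smul, smul_eq_mul]
      -- reduce both to the sum over `w.support ∩ T`
      have hsub1 : ∑ s ∈ w.support ∩ T, f s = ∑ s ∈ w.support, f s := by
        refine Finset.sum_subset Finset.inter_subset_left fun s hs hs' => ?_
        -- `s ∈ support`, `s ∉ T`: `s` has degree `M` but leaves the box, so `ℓ(x^i x^s) = 0`
        change coeff s w * ℓ (x i.1 * monomial s 1) = 0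
        have hdeg : s.degree = M := by
          by_contra h
          exact (MvPolynomial.mem_support_iff.mp hs) (hwN.coeff_eq_zero h)
        have hnot : (⇑s : Fin m → ℕ) ∉ indexSet m d M := fun h =>
          hs' (Finset.mem_inter.mpr ⟨hs, (hT s).mpr h⟩)
        have hbig : ∃ e, d - 1 ≤ s e := by
          by_contra h
          push Not at h
          exact hnot (mem_indexSet.mpr ⟨h, by rw [← Finsupp.degree_eq_sum]; exact hdeg⟩)
        rw [apply_mul_monomial_eq_zero_of_le ℓ hbox _ hbig, mul_zero]
      have hsub2 : ∑ s ∈ w.support ∩ T, f s = ∑ s ∈ T, f s := by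
        refine Finset.sum_subset Finset.inter_subset_right fun s hs hs' => ?_
        -- `s ∈ T`, `s ∉ support`: the coefficient vanishes
        have hcs : coeff s w = 0 := by
          by_contra h
          exact hs' (Finset.mem_inter.mpr ⟨MvPolynomial.mem_support_iff.mpr h, hs⟩)
        change coeff s w * _ = 0
        rw [hcs, zero_mul]
      rw [hR, hL, ← hsub1, ← hsub2]
  -- Step 2: on `S_M`, `Φ` is the pairing `B` followed by the evaluation `R` at the box monomials of `S_N`.
  let B := gradedMulForm ℓ M N
  let R : (homogeneousSubmodule (Fin m) K N →ₗ[K] K) →ₗ[K] (indexSet m d N → K) :=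
    LinearMap.pi fun i => LinearMap.applyₗ (⟨x i.1, hxmem i⟩ : homogeneousSubmodule (Fin m) K N)
  have hR : ∀ (g : homogeneousSubmodule (Fin m) K N →ₗ[K] K) i, R g i = g ⟨x i.1, hxmem i⟩ := fun g i => rfl
  have hΦRB : Φ ∘ₗ (homogeneousSubmodule (Fin m) K M).subtype = R ∘ₗ B := by
    refine LinearMap.ext fun v => funext fun i => ?_
    rw [LinearMap.comp_apply, LinearMap.comp_apply, hR, Submodule.subtype_apply, hΦ]
    change ℓ (x i.1 * v) = gradedMulForm ℓ M N v ⟨x i.1, hxmem i⟩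
    rw [gradedMulForm_apply, mul_comm]
  have h2 : (homogeneousSubmodule (Fin m) K M).map Φ = LinearMap.range (R ∘ₗ B) := by
    rw [← hΦRB, LinearMap.range_comp, Submodule.range_subtype]
  -- Step 3: `R` is injective on the range of `B` (a functional `ℓ(v·)` on `S_N` vanishing on the box monomials
  -- vanishes, the other monomials of `S_N` being killed anyway).
  have hinj : Function.Injective (R ∘ₗ (LinearMap.range B).subtype) := by
    refine (injective_iff_map_eq_zero _).mpr fun y hy => ?_
    obtain ⟨v, hv⟩ := LinearMap.mem_range.mp y.2
    apply Subtype.ext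
    rw [Submodule.coe_zero, ← hv]
    refine LinearMap.ext fun w => ?_
    rw [LinearMap.zero_apply]
    change gradedMulForm ℓ M N v w = 0
    rw [gradedMulForm_apply]
    have hwN : (w : MvPolynomial (Fin m) K).IsHomogeneous N := (mem_homogeneousSubmodule _ _).mp w.2
    have hy' : ∀ i : indexSet m d N, ℓ ((v : MvPolynomial (Fin m) K) * x i.1) = 0 := by
      intro i
      have := congr_fun hy i
      rw [LinearMap.comp_apply, Submodule.subtype_apply, hR, ← hv, Pi.zero_apply] at this
      change gradedMulForm ℓ M N v ⟨x i.1, hxmem i⟩ = 0 at this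
      rwa [gradedMulForm_apply] at this
    rw [(w : MvPolynomial (Fin m) K).as_sum, Finset.mul_sum, map_sum]
    refine Finset.sum_eq_zero fun s hs => ?_
    rw [monomial_eq_smul_monomial_one s, mul_smul_comm, map_smul, smul_eq_zero]
    by_cases hbig : ∃ e, d - 1 ≤ s e
    · exact Or.inr (apply_mul_monomial_eq_zero_of_le ℓ hbox _ hbig)
    · push Not at hbig
      right
      have hdeg : s.degree = N := by
        by_contra h
        exact (MvPolynomial.mem_support_iff.mp hs) (hwN.coeff_eq_zero h)
      have hsI : (⇑s : Fin m → ℕ) ∈ indexSet m d N :=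
        mem_indexSet.mpr ⟨hbig, by rw [← Finsupp.degree_eq_sum]; exact hdeg⟩
      have := hy' ⟨⇑s, hsI⟩
      rwa [hx, Finsupp.equivFunOnFinite_symm_coe] at this
  have h3 : finrank K (LinearMap.range (R ∘ₗ B)) = finrank K (LinearMap.range B) := by
    rw [LinearMap.range_comp, ← LinearMap.finrank_range_of_inj hinj, LinearMap.range_comp,
      Submodule.range_subtype]
  rw [Matrix.rank, h1, h2, h3]

/-- **`rank [p_{i+j}] = dim_K S_M − dim_K (Ann ℓ)_M = HF_{Ann ℓ}(M)`** (columns `I_M`, rows `I_N`) for a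
functional `ℓ` concentrated in degree `t = M + N` which kills the monomials of `J^F` — Movasati's Theorem 6
("`ker [p_{i+j}] = T_0V_{δ₀}`", `M = d`, `N = (n/2)d − n − 2`, `t = σ = (d−2)(n/2+1)`) read through
Villaflor's Definition 2.1 (`J^{F,λ} = Ann(ℓ_λ)`) and Proposition 2.1 (`T_tV_λ = J^{F,λ}_d`): the common
ALGEBRAIC content "`codim ker [p_{i+j}] = codim_{S_d} J^{F,λ}_d`"; the transcendental identifications with
the Zariski tangent space are not formalised. [cite: Movasati2016Periods, Theorem 6]
[cite: Villaflorloyola2021, Definition 2.1, Proposition 2.1] [cite: Kloosterman2025, Lemma 2.1] -/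
theorem rank_periodMatrix_eq_hilbert
    (hbox : ∀ s : Fin m →₀ ℕ, (∃ e, d - 1 ≤ s e) → ℓ (monomial s 1) = 0)
    {t N M : ℕ} (hℓ : ∀ p, ℓ (homogeneousComponent t p) = ℓ p) (hMN : M + N = t) :
    (periodMatrix m d N M (periodVector ℓ)).rank =
      finrank K (homogeneousSubmodule (Fin m) K M) - finrank K (idealDegree (annIdeal ℓ) M) := by
  rw [rank_periodMatrix_periodVector ℓ hbox, finrank_range_gradedMulForm hℓ hMN]

/-- Row form: **`rank [p_{i+j}] = HF_{Ann ℓ}(N)`** as well (Gorenstein symmetry `HF(M) = HF(σ − M)`,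
`σ = M + N`; Movasati: `#I_{(n/2)d−n−2} = h^{n/2+1,n/2−1}` rows). [cite: Movasati2016Periods, Theorem 6]
[cite: Villaflorloyola2021, Proposition 2.2] [cite: Kloosterman2025, Lemma 2.1] -/
theorem rank_periodMatrix_eq_hilbert_rows
    (hbox : ∀ s : Fin m →₀ ℕ, (∃ e, d - 1 ≤ s e) → ℓ (monomial s 1) = 0)
    {t N M : ℕ} (hℓ : ∀ p, ℓ (homogeneousComponent t p) = ℓ p) (hMN : M + N = t) :
    (periodMatrix m d N M (periodVector ℓ)).rank =
      finrank K (homogeneousSubmodule (Fin m) K N) - finrank K (idealDegree (annIdeal ℓ) N) := by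
  rw [rank_periodMatrix_eq_hilbert ℓ hbox hℓ hMN, hilbert_annIdeal_symm hℓ hMN]

/-- The same for a period vector given by a formula: if `p_i = ℓ(x^i)` for all `i`, then `rank [p_{i+j}] = HF_{Ann ℓ}(M)`.
[cite: Movasati2016Periods, Theorem 6] [cite: Villaflorloyola2021, Definition 2.1, Proposition 2.1] -/
theorem rank_periodMatrix_eq_hilbert_of_eq
    (hbox : ∀ s : Fin m →₀ ℕ, (∃ e, d - 1 ≤ s e) → ℓ (monomial s 1) = 0)
    {t N M : ℕ} (hℓ : ∀ p, ℓ (homogeneousComponent t p) = ℓ p) (hMN : M + N = t)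
    {p : (Fin m → ℕ) → K} (hp : ∀ i, p i = ℓ (monomial (Finsupp.equivFunOnFinite.symm i) 1)) :
    (periodMatrix m d N M p).rank =
      finrank K (homogeneousSubmodule (Fin m) K M) - finrank K (idealDegree (annIdeal ℓ) M) := by
  rw [show p = periodVector ℓ from funext hp]
  exact rank_periodMatrix_eq_hilbert ℓ hbox hℓ hMN

end Rank

end Literature.AlgebraicGeometry.Movasati2016

end
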